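import Mathlib
import HarnessLib

/-!
# Flow-based MCMC on a general state space: the independence Metropolis kernel is reversible

HONEST FRAMING: exact (Metropolis-corrected) sampling algorithms for lattice gauge theory;
figures of merit are autocorrelation/cost numbers at stated couplings and volumes; no
continuum-physics claim.

Venture `LatticeQCDFlow` (cell pub-lqcd), topic `Exactness`, FANOUT row 30 (lean-1); item L6
of HOME/THEORY-1.md §5 / HOME/VENTURE-STATEMENT.md ("general-state (`Kernel`) IMH — MISSING").
NEW WORK of the cell over Mathlib's Markov-kernel library (`ProbabilityTheory.Kernel`,
`Kernel.IsReversible`, `Kernel.Invariant`); nothing here is cited as a fact.  Printed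
counterparts, named only: Tierney 1994 §2.3 / 1998 (reversibility of Metropolis–Hastings
kernels on general spaces), Albergo–Kanwar–Shanahan 2019 §II.C and Kanwar et al. 2020 ("the
Markov chain is provably exact").

## Content

State space: any measurable space `Ω` (for lattice gauge theory `Ω = G^E` with its Borel
σ-algebra — no discretisation).  MODEL = the flow's output law `q`, an arbitrary probability
measure on `Ω`.  TARGET = `π = w · q`, given by a measurable, pointwise positive real density
`w = dπ/dq` (for a flow with tractable Jacobian, `w = p/q̃` with `p`, `q̃` the target and model
densities against the reference volume — `FlowPushforward.lean`; `π` need not be normalised).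

* `imhAccept w x y = min 1 (w y / w x)` — the acceptance probability;
* `indepMH q w : Kernel Ω Ω` — propose `y ∼ q` independently of `x`, accept with `imhAccept`,
  else stay: `K(x, ·) = a(x, ·) q + (1 − ∫ a(x, y) q(dy)) δ_x`, built from
  `Kernel.withDensity`, `Kernel.const`, `Kernel.deterministic`;
* `indepMH_apply` — the set-wise formula; `instIsMarkovKernelIndepMH` — it is a Markov kernel;
* `indepMH_isReversible` — **E1 on general state spaces**: `indepMH q w` is `π`-REVERSIBLE
  (Mathlib's `Kernel.IsReversible`: `∫_A K(x,B) dπ = ∫_B K(x,A) dπ` for all measurable `A, B`)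
  for EVERY model law `q` — the integrand `w(x) min(1, w(y)/w(x)) = min(w(x), w(y))` is symmetric
  and Tonelli swaps the two `q`-integrals;
* `indepMH_invariant` — hence `π` is invariant (`Kernel.Invariant`, Mathlib's
  `IsReversible.invariant`): the sampled law is EXACTLY the target whatever the flow; the
  flow's quality only enters the rejection mass `1 − ∫ a(x, y) q(dy)` (autocorrelations).

Not here: ergodicity / convergence rates (Mengersen–Tweedie: uniform ergodicity iff `w` is
`q`-essentially bounded — a Literature NAMED FACT for row 31), and the finite-state bounds of
`FlowMCMC.lean`.
-/

namespace Summit.Ventures.LatticeQCDFlow.Exactness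

open MeasureTheory ProbabilityTheory
open scoped ENNReal

variable {Ω : Type*} [MeasurableSpace Ω]

/-! ## The acceptance function -/

/-- The independence-Metropolis acceptance probability `min {1, w(y)/w(x)}` for a move `x → y`
proposed from the model, `w = dπ/dq` the target/model density ratio. -/
noncomputable def imhAccept (w : Ω → ℝ) (x y : Ω) : ℝ := min 1 (w y / w x)

omit [MeasurableSpace Ω] in
/-- The acceptance probability lies in `[0, 1]` when `w > 0`. -/
theorem imhAccept_nonneg {w : Ω → ℝ} (hw : ∀ x, 0 < w x) (x y : Ω) : 0 ≤ imhAccept w x y :=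
  le_min zero_le_one (div_nonneg (hw y).le (hw x).le)

omit [MeasurableSpace Ω] in
/-- The acceptance probability is at most one. -/
theorem imhAccept_le_one (w : Ω → ℝ) (x y : Ω) : imhAccept w x y ≤ 1 := min_le_left _ _

omit [MeasurableSpace Ω] in
/-- **The detailed-balance identity of the integrand**: `w(x) · min{1, w(y)/w(x)} = min{w(x), w(y)}`,
a symmetric function of `(x, y)`. -/
theorem mul_imhAccept {w : Ω → ℝ} (hw : ∀ x, 0 < w x) (x y : Ω) :
    w x * imhAccept w x y = min (w x) (w y) := by
  unfold imhAccept
  rw [mul_min_of_nonneg _ _ (hw x).le, mul_one, mul_div_assoc', mul_div_cancel_left₀ _ (hw x).ne']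

/-- The acceptance function, as an `ℝ≥0∞`-valued density of the proposal part of the kernel. -/
noncomputable def imhAcceptE (w : Ω → ℝ) (x y : Ω) : ℝ≥0∞ := ENNReal.ofReal (imhAccept w x y)

/-- Joint measurability of the acceptance density. -/
theorem measurable_imhAcceptE {w : Ω → ℝ} (hw : Measurable w) :
    Measurable (Function.uncurry (imhAcceptE w)) := by
  unfold imhAcceptE imhAccept
  exact (measurable_const.min ((hw.comp measurable_snd).div (hw.comp measurable_fst))).ennreal_ofReal

omit [MeasurableSpace Ω] in
/-- The acceptance density is at most one. -/
theorem imhAcceptE_le_one (w : Ω → ℝ) (x y : Ω) : imhAcceptE w x y ≤ 1 := by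
  unfold imhAcceptE
  rw [← ENNReal.ofReal_one]
  exact ENNReal.ofReal_le_ofReal (imhAccept_le_one w x y)

omit [MeasurableSpace Ω] in
/-- Symmetry of `w(x) a(x,y)` in `ℝ≥0∞`: `ofReal (w x) * a x y = ofReal (min (w x) (w y))`. -/
theorem ofReal_mul_imhAcceptE {w : Ω → ℝ} (hw : ∀ x, 0 < w x) (x y : Ω) :
    ENNReal.ofReal (w x) * imhAcceptE w x y = ENNReal.ofReal (min (w x) (w y)) := by
  rw [imhAcceptE, ← ENNReal.ofReal_mul (hw x).le, mul_imhAccept hw]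

/-! ## The kernel -/

/-- Total acceptance mass from `x`: `A(x) = ∫ a(x, y) q(dy) ≤ 1`. -/
noncomputable def imhAcceptMass (q : Measure Ω) (w : Ω → ℝ) (x : Ω) : ℝ≥0∞ :=
  ∫⁻ y, imhAcceptE w x y ∂q

/-- Measurability of the acceptance mass. -/
theorem measurable_imhAcceptMass (q : Measure Ω) [SFinite q] {w : Ω → ℝ} (hw : Measurable w) :
    Measurable (imhAcceptMass q w) :=
  (measurable_imhAcceptE hw).lintegral_prod_right

/-- The acceptance mass is at most one for a probability proposal. -/
theorem imhAcceptMass_le_one (q : Measure Ω) [IsProbabilityMeasure q] (w : Ω → ℝ) (x : Ω) :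
    imhAcceptMass q w x ≤ 1 := by
  unfold imhAcceptMass
  calc ∫⁻ y, imhAcceptE w x y ∂q ≤ ∫⁻ _, 1 ∂q := lintegral_mono fun y => imhAcceptE_le_one w x y
    _ = 1 := by rw [lintegral_const, measure_univ, mul_one]

/-- **The flow-MCMC (independence Metropolis–Hastings) kernel on a general state space.**
From `x`: propose `y ∼ q` (the flow model, independent of `x`), accept with probability
`min {1, w(y)/w(x)}`, otherwise stay at `x`:
`K(x, dy) = a(x, y) q(dy) + (1 − ∫ a(x, y') q(dy')) δ_x(dy)`. -/
noncomputable def indepMH (q : Measure Ω) [IsProbabilityMeasure q] (w : Ω → ℝ) : Kernel Ω Ω :=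
  Kernel.withDensity (Kernel.const Ω q) (imhAcceptE w) +
    Kernel.withDensity (Kernel.deterministic id measurable_id)
      (fun x _ => 1 - imhAcceptMass q w x)

variable {q : Measure Ω} [IsProbabilityMeasure q] {w : Ω → ℝ}

/-- Set-wise formula: `K(x, B) = ∫_B a(x, y) q(dy) + (1 − A(x)) · 1_B(x)`. -/
theorem indepMH_apply (hw : Measurable w) (x : Ω) {B : Set Ω} (hB : MeasurableSet B) :
    indepMH q w x B =
      ∫⁻ y in B, imhAcceptE w x y ∂q + (1 - imhAcceptMass q w x) * B.indicator 1 x := by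
  have h2 : Measurable (Function.uncurry fun (x : Ω) (_ : Ω) => 1 - imhAcceptMass q w x) :=
    measurable_const.sub ((measurable_imhAcceptMass q hw).comp measurable_fst)
  rw [indepMH, Kernel.add_apply, Measure.add_apply,
    Kernel.withDensity_apply' _ (measurable_imhAcceptE hw), Kernel.const_apply,
    Kernel.withDensity_apply' _ h2, Kernel.deterministic_apply, setLIntegral_const, id,
    Measure.dirac_apply' x hB]

/-- The flow-MCMC kernel is a Markov kernel (total mass one from every state). -/
instance instIsMarkovKernelIndepMH [Fact (Measurable w)] : IsMarkovKernel (indepMH q w) := by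
  refine ⟨fun x => ⟨?_⟩⟩
  rw [indepMH_apply (Fact.out) x MeasurableSet.univ, Measure.restrict_univ, Set.indicator_univ,
    Pi.one_apply, mul_one]
  exact add_tsub_cancel_of_le (imhAcceptMass_le_one q w x)

/-- The Markov property without the `Fact` instance: `K(x, Ω) = 1`. -/
theorem indepMH_apply_univ (hw : Measurable w) (x : Ω) : indepMH q w x Set.univ = 1 := by
  haveI : Fact (Measurable w) := ⟨hw⟩
  exact measure_univ

/-! ## Reversibility (detailed balance) and invariance -/

/-- The "mass flow" `∫_A K(x, B) dπ(x)` for `π = w · q`, split into the symmetric proposal part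
and the diagonal rejection part. -/
theorem setLIntegral_indepMH (hw : Measurable w) (hw0 : ∀ x, 0 < w x) {A B : Set Ω}
    (hA : MeasurableSet A) (hB : MeasurableSet B) :
    ∫⁻ x in A, indepMH q w x B ∂(q.withDensity fun x => ENNReal.ofReal (w x)) =
      (∫⁻ x in A, ∫⁻ y in B, ENNReal.ofReal (min (w x) (w y)) ∂q ∂q) +
        ∫⁻ x in B ∩ A, ENNReal.ofReal (w x) * (1 - imhAcceptMass q w x) ∂q := by
  have hd : Measurable fun x => ENNReal.ofReal (w x) := hw.ennreal_ofReal
  have hK : Measurable fun x => indepMH q w x B := Kernel.measurable_coe _ hB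
  have hR : Measurable fun x => 1 - imhAcceptMass q w x :=
    measurable_const.sub (measurable_imhAcceptMass q hw)
  rw [setLIntegral_withDensity_eq_setLIntegral_mul _ hd hK hA]
  simp only [Pi.mul_apply]
  have hpt : ∀ x, ENNReal.ofReal (w x) * indepMH q w x B =
      ENNReal.ofReal (w x) * ∫⁻ y in B, imhAcceptE w x y ∂q +
        B.indicator (fun x => ENNReal.ofReal (w x) * (1 - imhAcceptMass q w x)) x := by
    intro x
    rw [indepMH_apply hw x hB, mul_add]
    congr 1
    by_cases hx : x ∈ B
    · rw [Set.indicator_of_mem hx, Set.indicator_of_mem hx, Pi.one_apply, mul_one]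
    · rw [Set.indicator_of_notMem hx, Set.indicator_of_notMem hx, mul_zero, mul_zero]
  simp_rw [hpt]
  have hind : Measurable
      (B.indicator fun x => ENNReal.ofReal (w x) * (1 - imhAcceptMass q w x)) :=
    (hd.mul hR).indicator hB
  rw [lintegral_add_right _ hind, lintegral_indicator hB, Measure.restrict_restrict hB]
  congr 1
  refine lintegral_congr fun x => ?_
  rw [← lintegral_const_mul _ ((measurable_imhAcceptE hw).of_uncurry_left)]
  refine lintegral_congr fun y => ?_
  exact ofReal_mul_imhAcceptE hw0 x y

/-- **E1 on general state spaces — the flow-MCMC kernel is reversible.**  For EVERY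
probability law `q` (the flow model) and every measurable target density `w = dπ/dq > 0`, the
independence Metropolis kernel `indepMH q w` satisfies detailed balance with respect to
`π = w · q` (Mathlib's `Kernel.IsReversible`). -/
theorem indepMH_isReversible (hw : Measurable w) (hw0 : ∀ x, 0 < w x) :
    Kernel.IsReversible (indepMH q w) (q.withDensity fun x => ENNReal.ofReal (w x)) := by
  intro A B hA hB
  rw [setLIntegral_indepMH hw hw0 hA hB, setLIntegral_indepMH hw hw0 hB hA, Set.inter_comm]
  congr 1
  have hs : Measurable (Function.uncurry fun x y : Ω => ENNReal.ofReal (min (w x) (w y))) :=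
    ((hw.comp measurable_fst).min (hw.comp measurable_snd)).ennreal_ofReal
  rw [lintegral_lintegral_swap (hs.aemeasurable (μ := (q.restrict A).prod (q.restrict B)))]
  refine lintegral_congr fun y => lintegral_congr fun x => ?_
  rw [min_comm]

/-- **Exactness**: the target `π = w · q` is INVARIANT under the flow-MCMC kernel, for every
model law `q` — the flow never biases the sampled distribution; its quality only enters the
rejection mass (hence the autocorrelation time). -/
theorem indepMH_invariant (hw : Measurable w) (hw0 : ∀ x, 0 < w x) :
    Kernel.Invariant (indepMH q w) (q.withDensity fun x => ENNReal.ofReal (w x)) := by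
  haveI : Fact (Measurable w) := ⟨hw⟩
  exact (indepMH_isReversible hw hw0).invariant

/-! ## The price of a bad model: general-state-space entry and holding bounds

(Appended 2026-08-21 by row 30.)  The general-space versions of S3 and S2 of `FlowMCMC.lean`:
from `x`, the chain moves into a set `B ∌ x` with probability at most the MODEL mass `q(B)`
(mode collapse of the flow = topological freezing of the exact chain), and it moves at all with
probability at most `A(x) ≤ (∫ w dq) / w(x)` — the continuous core of Mengersen–Tweedie's
criterion (uniform ergodicity iff `w` is essentially bounded). -/

/-- **S3 on general spaces (sector-entry bound).**  From any `x ∉ B` the flow-MCMC chain enters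
`B` in one step with probability at most `∫_B a(x,y) q(dy) ≤ q(B)`, whatever the target mass of
`B`: a sector the model under-covers is entered at most at the model's rate. -/
theorem indepMH_apply_le_of_not_mem (hw : Measurable w) {x : Ω} {B : Set Ω}
    (hB : MeasurableSet B) (hx : x ∉ B) : indepMH q w x B ≤ q B := by
  rw [indepMH_apply hw x hB, Set.indicator_of_notMem hx, mul_zero, add_zero]
  calc ∫⁻ y in B, imhAcceptE w x y ∂q ≤ ∫⁻ _ in B, 1 ∂q :=
        lintegral_mono fun y => imhAcceptE_le_one w x y
    _ = q B := by rw [setLIntegral_const, one_mul]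

/-- From any `x ∉ B`, the one-step probability of `B` is at most the total acceptance mass
`A(x)`. -/
theorem indepMH_apply_le_imhAcceptMass (hw : Measurable w) {x : Ω} {B : Set Ω}
    (hB : MeasurableSet B) (hx : x ∉ B) : indepMH q w x B ≤ imhAcceptMass q w x := by
  rw [indepMH_apply hw x hB, Set.indicator_of_notMem hx, mul_zero, add_zero]
  exact setLIntegral_le_lintegral B _

omit [IsProbabilityMeasure q] in
/-- **S2 on general spaces (Mengersen–Tweedie core).**  The acceptance mass from `x` is at most
`(∫ w dq) / w(x) = Z_π / w(x)`: wherever the model under-covers the target (`w(x) ≫ Z_π`) the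
exact chain holds for `≳ w(x)/Z_π` steps — at ANY mean acceptance. -/
theorem imhAcceptMass_le (hw0 : ∀ x, 0 < w x) (x : Ω) :
    imhAcceptMass q w x ≤ ENNReal.ofReal (w x)⁻¹ * ∫⁻ y, ENNReal.ofReal (w y) ∂q := by
  unfold imhAcceptMass
  rw [← lintegral_const_mul' _ _ ENNReal.ofReal_ne_top]
  refine lintegral_mono fun y => ?_
  unfold imhAcceptE imhAccept
  rw [← ENNReal.ofReal_mul (inv_nonneg.mpr (hw0 x).le)]
  refine ENNReal.ofReal_le_ofReal ((min_le_right _ _).trans_eq ?_)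
  rw [div_eq_inv_mul]

/-! ## Mode collapse ⇒ slow filling of an under-covered set (general-space T2-D)

(Appended 2026-08-21 by row 30.)  One step of the chain raises the probability of any set `A`
by at most the MODEL mass `q(A)`; hence after `t` steps from ANY initial law `μ`,
`μKᵗ(A) ≤ μ(A) + t·q(A)`: filling a sector of target mass `π(A)` that the flow under-covers and
the start under-weights takes `t ≥ (π(A) − μ(A))/q(A)` steps — exactness is kept, the cost
moves into the autocorrelation time (the general-space form of `imh_sector_mixing_lower_bound`
of `FlowMCMC.lean`, without the total-variation packaging). -/

/-- One step raises the mass of `A` by at most `q(A)`: `(μK)(A) ≤ μ(A) + q(A)`. -/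
theorem bind_indepMH_apply_le (hw : Measurable w) (μ : Measure Ω) [IsProbabilityMeasure μ]
    {A : Set Ω} (hA : MeasurableSet A) : (μ.bind (indepMH q w)) A ≤ μ A + q A := by
  haveI : Fact (Measurable w) := ⟨hw⟩
  rw [Measure.bind_apply hA (Kernel.aemeasurable _), ← lintegral_add_compl _ hA]
  have h1 : ∫⁻ x in A, indepMH q w x A ∂μ ≤ μ A :=
    calc ∫⁻ x in A, indepMH q w x A ∂μ ≤ ∫⁻ _ in A, 1 ∂μ := lintegral_mono fun x => prob_le_one
      _ = μ A := by rw [setLIntegral_const, one_mul]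
  have h2 : ∫⁻ x in Aᶜ, indepMH q w x A ∂μ ≤ q A :=
    calc ∫⁻ x in Aᶜ, indepMH q w x A ∂μ ≤ ∫⁻ _ in Aᶜ, q A ∂μ :=
          setLIntegral_mono' hA.compl fun x hx => indepMH_apply_le_of_not_mem hw hA hx
      _ = q A * μ Aᶜ := setLIntegral_const _ _
      _ ≤ q A * 1 := mul_le_mul' le_rfl prob_le_one
      _ = q A := mul_one _
  exact add_le_add h1 h2

/-- **T2-D on general spaces.**  After `t` steps of the flow-MCMC chain from any initial law
`μ`, the probability of `A` is at most `μ(A) + t · q(A)`. -/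
theorem iterate_bind_indepMH_apply_le (hw : Measurable w) {A : Set Ω} (hA : MeasurableSet A) :
    ∀ (t : ℕ) (μ : Measure Ω) [IsProbabilityMeasure μ],
      ((fun ν : Measure Ω => ν.bind (indepMH q w))^[t] μ) A ≤ μ A + t * q A
  | 0, μ, _ => by simp
  | t + 1, μ, _ => by
    haveI : Fact (Measurable w) := ⟨hw⟩
    rw [Function.iterate_succ_apply]
    calc ((fun ν : Measure Ω => ν.bind (indepMH q w))^[t] (μ.bind (indepMH q w))) A
          ≤ (μ.bind (indepMH q w)) A + t * q A := iterate_bind_indepMH_apply_le hw hA t _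
      _ ≤ μ A + q A + t * q A := add_le_add (bind_indepMH_apply_le hw μ hA) le_rfl
      _ = μ A + (t + 1 : ℕ) * q A := by push_cast; ring

/-! ## The converse direction: a bounded weight gives a Doeblin minorisation

(Appended 2026-08-21 by row 30.)  If the importance weight is BOUNDED, `w ≤ M`, then from every
state the flow-MCMC kernel dominates a fixed multiple of the (un-normalised) target:
`K(x, B) ≥ M⁻¹ · π(B)` with `π = w · q` — Doeblin's condition with constant
`ε = π(Ω)/M = 1/w⋆` (`w⋆` = the normalised weight's supremum), the hypothesis under which the
independence sampler is uniformly ergodic with rate `(1 − 1/w⋆)ᵗ` (Mengersen–Tweedie 1996,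
Thm 2.1, sufficiency direction; the TV-contraction step itself is not formalised here). -/

omit [MeasurableSpace Ω] [IsProbabilityMeasure q] in
/-- Under `w ≤ M` (and `w > 0`) the acceptance density from ANY `x` is at least `w(y)/M`. -/
theorem imhAcceptE_ge_of_le {M : ℝ} (hw0 : ∀ x, 0 < w x) (hM : ∀ x, w x ≤ M) (x y : Ω) :
    ENNReal.ofReal (w y / M) ≤ imhAcceptE w x y := by
  have hMpos : 0 < M := (hw0 x).trans_le (hM x)
  unfold imhAcceptE imhAccept
  refine ENNReal.ofReal_le_ofReal (le_min ?_ ?_)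
  · rw [div_le_one hMpos]; exact hM y
  · exact div_le_div_of_nonneg_left (hw0 y).le (hw0 x) (hM x)

/-- **Doeblin minorisation for a bounded weight.**  If `0 < w ≤ M`, then for every state `x`
and measurable `B`: `M⁻¹ · π(B) ≤ K(x, B)` with `π = w · q`; i.e. `K(x, ·) ≥ (π(Ω)/M) · π̄(·)`
for the normalised target `π̄`. -/
theorem indepMH_apply_ge (hw : Measurable w) {M : ℝ} (hw0 : ∀ x, 0 < w x) (hM : ∀ x, w x ≤ M)
    (x : Ω) {B : Set Ω} (hB : MeasurableSet B) :
    (ENNReal.ofReal M)⁻¹ * (q.withDensity fun y => ENNReal.ofReal (w y)) B ≤ indepMH q w x B := by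
  have hMpos : 0 < M := (hw0 x).trans_le (hM x)
  rw [indepMH_apply hw x hB, withDensity_apply _ hB]
  calc (ENNReal.ofReal M)⁻¹ * ∫⁻ y in B, ENNReal.ofReal (w y) ∂q
        = ∫⁻ y in B, (ENNReal.ofReal M)⁻¹ * ENNReal.ofReal (w y) ∂q := by
          rw [lintegral_const_mul _ hw.ennreal_ofReal]
    _ = ∫⁻ y in B, ENNReal.ofReal (w y / M) ∂q := by
          refine lintegral_congr fun y => ?_
          rw [div_eq_inv_mul, ENNReal.ofReal_mul (inv_nonneg.mpr hMpos.le),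
            ENNReal.ofReal_inv_of_pos hMpos]
    _ ≤ ∫⁻ y in B, imhAcceptE w x y ∂q := lintegral_mono fun y => imhAcceptE_ge_of_le hw0 hM x y
    _ ≤ ∫⁻ y in B, imhAcceptE w x y ∂q + (1 - imhAcceptMass q w x) * B.indicator 1 x :=
          le_self_add

end Summit.Ventures.LatticeQCDFlow.Exactness
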